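import Mathlib
import HarnessLib
import Summits.QuantumFields.YangMills.Theses.PencilRigidity
import Summits.QuantumFields.YangMills.Theorems.PencilRigidityCurvatureKernelBoundKernelPinning
import Summits.QuantumFields.YangMills.Theorems.PencilRigidityCurvatureKernelBoundReduction

/-!
# `CurvatureKernelBound` — the reduction PER INHABITANT (support for stmt-QuantumFields-11687)

Support file for crux `stmt-QuantumFields-11687` (`PencilRigidity.CurvatureKernelBound`), line
`sixteen-charts-analytic-kernel`, continuation lead c1. The landed reduction
(`PencilRigidityCurvatureKernelBoundReduction.lean`) is stated between UNIVERSAL statements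
(`DiagonalMirrorRPR → AxialGrowth → CurvatureKernelBound`, all three quantified over every `W₁`-inhabitant of every
scheme), but the route's deciding theorem `closes` applies the crux to ONE inhabitant only — the curvature channel of
the witness produced by `HypercubicLimit`. This file records the reduction at the level at which it is actually true
and used, one Schwinger family at a time and MODEL-BLIND (no gauge group, no scheme):

* `kernelConclusion_of_diagonalFrames_of_axialGrowth` — for a one-species family `S₁` on `ℝ⁴` with the OS package of
  `W₁`, translation and proper signed-permutation invariance on `⁰𝒮`, reflection positivity in pull-back form for the
  four diagonal frames, a two-point function REAL on real off-diagonal tensors, and the axial growth bound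
  `‖K(s e₀)‖ ≤ C s^(η−10)` on `(0,1]` for every continuous representing kernel: the conclusion of the crux holds for
  `S₁` (real kernel continuous off `0`, `|K x| ≤ C (1 + ‖x‖^(η−10))`, representation on `⁰𝒮`);
* `axialGrowth_of_kernelConclusion` — conversely the conclusion of the crux for `S₁` forces the axial growth bound for
  every continuous representing kernel (kernel uniqueness off the origin);
* `kernelConclusion_of_witness` — the same sufficiency with the reality clause discharged from the lattice tie of
  `W₁` at `n = 2` (limits of real numbers are real), for ONE datum `(G, r, sch, S₁)`: the form a strengthened existence
  leg ("`HypercubicLimit` ∧ diagonal RP of the witness ∧ axial growth of the witness") would consume.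
[folklore]
-/

noncomputable section

open scoped BigOperators Topology SchwartzMap ComplexConjugate
open MeasureTheory Filter Set
open Literature.MathematicalPhysics.QuantumLattice Literature.MathematicalPhysics.AQFT
  Literature.MathematicalPhysics.QuantumFieldTheory

namespace Summit.QuantumFields.YangMills.Theorems.CurvatureKernel

/-- **Sufficiency per family (model-blind).** OS package + translations + proper signed permutations + the four diagonal
frames + reality on real off-diagonal tensors + the axial growth bound for every continuous representing kernel ⇒ the
kernel conclusion of `CurvatureKernelBound` for this family: `K_real := re ∘ K` for the lever's kernel `K`
(`mirrorChartRegularity`), `C_total := k(1/2) + |C| / 2^(η−10)` by the axial envelope (`AxisEnvelope`). [folklore] -/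
theorem kernelConclusion_of_diagonalFrames_of_axialGrowth (S₁ : SchwingerFamily (EuclideanSpace ℝ (Fin 4)))
    (hpkg : S₁.toLabelled.IsNormalized ∧ S₁.toLabelled.IsHermitian ∧ S₁.toLabelled.HasLinearGrowth ∧
      S₁.toLabelled.IsReflectionPositive ∧ S₁.toLabelled.IsSymmetric ∧ S₁.toLabelled.HasClusterProperty)
    (htr : ∀ (n : ℕ) (a : EuclideanSpace ℝ (Fin 4)) (F : 𝓢((Fin n → EuclideanSpace ℝ (Fin 4)), ℂ)),
      IsOffDiagonal F → S₁ n (translateMulti a F) = S₁ n F)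
    (hhyp : ∀ (R : EuclideanSpace ℝ (Fin 4) ≃ₗᵢ[ℝ] EuclideanSpace ℝ (Fin 4)),
      LinearMap.det (R.toLinearEquiv : EuclideanSpace ℝ (Fin 4) →ₗ[ℝ] EuclideanSpace ℝ (Fin 4)) = 1 →
      (∀ i : Fin 4, ∃ j : Fin 4, R (EuclideanSpace.single i 1) = EuclideanSpace.single j 1 ∨
        R (EuclideanSpace.single i 1) = -EuclideanSpace.single j 1) →
      ∀ (n : ℕ) (F : 𝓢((Fin n → EuclideanSpace ℝ (Fin 4)), ℂ)), IsOffDiagonal F → S₁ n (linActMulti R F) = S₁ n F)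
    (hdiag : ∀ (R : EuclideanSpace ℝ (Fin 4) ≃ₗᵢ[ℝ] EuclideanSpace ℝ (Fin 4)) (a b : ℝ), a ^ 2 = 1 / 2 →
      b ^ 2 = 1 / 2 → R (EuclideanSpace.single 0 1) = a • EuclideanSpace.single 0 1 + b • EuclideanSpace.single 1 1 →
      (SchwingerFamily.toLabelled (fun n => (S₁ n).comp (linActMulti R))).IsReflectionPositive)
    (hreal : ∀ (f : Fin 2 → 𝓢((EuclideanSpace ℝ (Fin 4)), ℝ)) (F : 𝓢((Fin 2 → EuclideanSpace ℝ (Fin 4)), ℂ)),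
      IsTensorOf F (fun i => ofRealTest (f i)) → IsOffDiagonal F → (S₁ 2 F).im = 0)
    (hax : ∀ K : EuclideanSpace ℝ (Fin 4) → ℂ, ContinuousOn K {x : EuclideanSpace ℝ (Fin 4) | x ≠ 0} →
      (∀ F : 𝓢((Fin 2 → EuclideanSpace ℝ (Fin 4)), ℂ), IsOffDiagonal F →
        Integrable (fun x : Fin 2 → EuclideanSpace ℝ (Fin 4) => K (x 0 - x 1) * F x) ∧
          S₁ 2 F = ∫ x : Fin 2 → EuclideanSpace ℝ (Fin 4), K (x 0 - x 1) * F x) →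
      ∃ C η : ℝ, 0 < η ∧ ∀ s : ℝ, 0 < s → s ≤ 1 → ‖K (EuclideanSpace.single 0 s)‖ ≤ C * s ^ (η - 10)) :
    ∃ (K : EuclideanSpace ℝ (Fin 4) → ℝ) (C η : ℝ), 0 < η ∧ ContinuousOn K {x : EuclideanSpace ℝ (Fin 4) | x ≠ 0} ∧
      (∀ x : EuclideanSpace ℝ (Fin 4), x ≠ 0 → |K x| ≤ C * (1 + ‖x‖ ^ (η - 10))) ∧
      ∀ F : 𝓢((Fin 2 → EuclideanSpace ℝ (Fin 4)), ℂ), IsOffDiagonal F →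
        Integrable (fun x : Fin 2 → EuclideanSpace ℝ (Fin 4) => (K (x 0 - x 1) : ℂ) * F x) ∧
          S₁ 2 F = ∫ x : Fin 2 → EuclideanSpace ℝ (Fin 4), (K (x 0 - x 1) : ℂ) * F x := by
  -- (A) the complex kernel, continuous off 0, representing S₁ 2 on ⁰𝒮 (the lever, from the sixteen mirrors)
  obtain ⟨K, hcont, hrep⟩ := mirrorChartRegularity S₁ hpkg htr hhyp hdiag
  -- (C) the kernel is real off 0
  have him : ∀ x, x ≠ 0 → (K x).im = 0 := LatticeReality S₁ K hcont hrep hreal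
  -- (B) the axial envelope (axis reflection positivity only)
  obtain ⟨hpos, hmono, henv⟩ := AxisEnvelope S₁ K hpkg.2.2.2.1 htr hhyp hcont hrep
  -- (E) the UV datum: growth of k(s) = K(s e₀) on (0, 1]
  obtain ⟨C, η, hη, hgrowth⟩ := hax K hcont hrep
  -- constants
  set k₀ : ℝ := (K (EuclideanSpace.single 0 (1 / 2 : ℝ))).re with hk₀
  have hk₀nn : 0 ≤ k₀ := (hpos (1 / 2) (by norm_num)).2
  have h2pos : (0 : ℝ) < 2 ^ (η - 10) := Real.rpow_pos_of_pos (by norm_num) _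
  set C₁ : ℝ := |C| / 2 ^ (η - 10) with hC₁
  have hC₁nn : 0 ≤ C₁ := div_nonneg (abs_nonneg C) h2pos.le
  refine ⟨fun x => (K x).re, k₀ + C₁, η, hη, ?_, ?_, ?_⟩
  · -- continuity off 0
    exact Complex.continuous_re.comp_continuousOn hcont
  · -- the bound |K_real x| ≤ (k₀ + C₁) (1 + ‖x‖^(η-10))
    intro x hx
    have htpos : 0 < ‖x‖ := norm_pos_iff.mpr hx
    have hrnn : 0 ≤ ‖x‖ ^ (η - 10) := Real.rpow_nonneg htpos.le _
    have h1 : |(K x).re| ≤ (K (EuclideanSpace.single 0 (‖x‖ / 2))).re :=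
      (Complex.abs_re_le_norm _).trans (henv x hx)
    by_cases hle : ‖x‖ ≤ 1
    · have h2 : (K (EuclideanSpace.single 0 (‖x‖ / 2))).re ≤ C * (‖x‖ / 2) ^ (η - 10) :=
        (Complex.re_le_norm _).trans (hgrowth (‖x‖ / 2) (half_pos htpos) (by linarith))
      have h3 : C * (‖x‖ / 2) ^ (η - 10) ≤ C₁ * ‖x‖ ^ (η - 10) := by
        rw [Real.div_rpow htpos.le zero_le_two, hC₁]
        calc C * (‖x‖ ^ (η - 10) / 2 ^ (η - 10))
            ≤ |C| * (‖x‖ ^ (η - 10) / 2 ^ (η - 10)) :=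
              mul_le_mul_of_nonneg_right (le_abs_self C) (div_nonneg hrnn h2pos.le)
          _ = |C| / 2 ^ (η - 10) * ‖x‖ ^ (η - 10) := by ring
      calc |(K x).re| ≤ C₁ * ‖x‖ ^ (η - 10) := h1.trans (h2.trans h3)
        _ ≤ (k₀ + C₁) * ‖x‖ ^ (η - 10) := by nlinarith [hk₀nn, hrnn]
        _ ≤ (k₀ + C₁) * (1 + ‖x‖ ^ (η - 10)) := by nlinarith [hk₀nn, hC₁nn, hrnn]
    · have hlt : 1 < ‖x‖ := lt_of_not_ge hle
      have h2 : (K (EuclideanSpace.single 0 (‖x‖ / 2))).re ≤ k₀ :=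
        hmono (Set.mem_Ioi.mpr (by norm_num : (0 : ℝ) < 1 / 2)) (Set.mem_Ioi.mpr (half_pos htpos))
          (by linarith)
      calc |(K x).re| ≤ k₀ := h1.trans h2
        _ ≤ (k₀ + C₁) * 1 := by linarith [hC₁nn]
        _ ≤ (k₀ + C₁) * (1 + ‖x‖ ^ (η - 10)) := by nlinarith [hk₀nn, hC₁nn, hrnn]
  · -- the representation on ⁰𝒮 with the real kernel: the integrands coincide pointwise
    intro F hF
    have hfun : (fun y : Fin 2 → EuclideanSpace ℝ (Fin 4) => (((K (y 0 - y 1)).re : ℝ) : ℂ) * F y) =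
        fun y => K (y 0 - y 1) * F y := by
      funext y
      by_cases h : y 0 = y 1
      · have hy : y ∈ coincidenceLocus 2 (EuclideanSpace ℝ (Fin 4)) :=
          (mem_coincidenceLocus y).mpr ⟨0, 1, by decide, h⟩
        simp [hF.apply_eq_zero hy]
      · have hne : y 0 - y 1 ≠ 0 := sub_ne_zero.mpr h
        congr 1
        exact Complex.ext (by simp) (by simp [him _ hne])
    obtain ⟨hint, hSF⟩ := hrep F hF
    refine ⟨?_, ?_⟩
    · rw [hfun]; exact hint
    · rw [hfun]; exact hSF

/-- **Necessity per family (model-blind).** If the kernel conclusion of `CurvatureKernelBound` holds for `S₁`, then EVERY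
kernel continuous off `0` representing `S₁ 2` on `⁰𝒮` obeys the axial growth bound `‖K(s e₀)‖ ≤ C' s^(η'−10)` on `(0,1]`
(with `C' = 2 max C 0`, `η' = min η 10`): two continuous representing kernels agree off the origin
(`kernel_unique_of_realTensor`). [folklore] -/
theorem axialGrowth_of_kernelConclusion (S₁ : SchwingerFamily (EuclideanSpace ℝ (Fin 4)))
    (hconcl : ∃ (K : EuclideanSpace ℝ (Fin 4) → ℝ) (C η : ℝ), 0 < η ∧
      ContinuousOn K {x : EuclideanSpace ℝ (Fin 4) | x ≠ 0} ∧
      (∀ x : EuclideanSpace ℝ (Fin 4), x ≠ 0 → |K x| ≤ C * (1 + ‖x‖ ^ (η - 10))) ∧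
      ∀ F : 𝓢((Fin 2 → EuclideanSpace ℝ (Fin 4)), ℂ), IsOffDiagonal F →
        Integrable (fun x : Fin 2 → EuclideanSpace ℝ (Fin 4) => (K (x 0 - x 1) : ℂ) * F x) ∧
          S₁ 2 F = ∫ x : Fin 2 → EuclideanSpace ℝ (Fin 4), (K (x 0 - x 1) : ℂ) * F x)
    (K : EuclideanSpace ℝ (Fin 4) → ℂ) (hcont : ContinuousOn K {x : EuclideanSpace ℝ (Fin 4) | x ≠ 0})
    (hrep : ∀ F : 𝓢((Fin 2 → EuclideanSpace ℝ (Fin 4)), ℂ), IsOffDiagonal F →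
      Integrable (fun x : Fin 2 → EuclideanSpace ℝ (Fin 4) => K (x 0 - x 1) * F x) ∧
        S₁ 2 F = ∫ x : Fin 2 → EuclideanSpace ℝ (Fin 4), K (x 0 - x 1) * F x) :
    ∃ C η : ℝ, 0 < η ∧ ∀ s : ℝ, 0 < s → s ≤ 1 → ‖K (EuclideanSpace.single 0 s)‖ ≤ C * s ^ (η - 10) := by
  obtain ⟨K', C, η, hη, hcont', hbd, hrep'⟩ := hconcl
  -- uniqueness of continuous representing kernels off the origin: `K = K'` there
  have hKK : ∀ x : EuclideanSpace ℝ (Fin 4), x ≠ 0 → K x = ((K' x : ℝ) : ℂ) :=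
    kernel_unique_of_realTensor hcont (Complex.continuous_ofReal.comp_continuousOn hcont')
      (fun f F _ hoff _ _ => ⟨(hrep F hoff).1, (hrep' F hoff).1, by rw [← (hrep F hoff).2, ← (hrep' F hoff).2]⟩)
  refine ⟨2 * max C 0, min η 10, lt_min hη (by norm_num), fun s hs hs1 => ?_⟩
  have hx : (EuclideanSpace.single (0 : Fin 4) s : EuclideanSpace ℝ (Fin 4)) ≠ 0 := by
    intro h0
    have := congrArg (fun v : EuclideanSpace ℝ (Fin 4) => v 0) h0
    simp at this
    exact hs.ne' this
  have hns : ‖(EuclideanSpace.single (0 : Fin 4) s : EuclideanSpace ℝ (Fin 4))‖ = s := by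
    rw [PiLp.norm_single, Real.norm_eq_abs, abs_of_pos hs]
  have h1 : (1 : ℝ) ≤ s ^ (min η 10 - 10) :=
    Real.one_le_rpow_of_pos_of_le_one_of_nonpos hs hs1 (by linarith [min_le_right η 10])
  have h2 : s ^ (η - 10) ≤ s ^ (min η 10 - 10) :=
    Real.rpow_le_rpow_of_exponent_ge hs hs1 (by linarith [min_le_left η 10])
  have hC : C ≤ max C 0 := le_max_left _ _
  have hC0 : 0 ≤ max C 0 := le_max_right _ _
  have hpos : 0 ≤ 1 + s ^ (η - 10) := by positivity
  rw [hKK _ hx, Complex.norm_real, Real.norm_eq_abs]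
  calc |K' (EuclideanSpace.single 0 s)| ≤ C * (1 + ‖(EuclideanSpace.single (0 : Fin 4) s :
        EuclideanSpace ℝ (Fin 4))‖ ^ (η - 10)) := hbd _ hx
    _ = C * (1 + s ^ (η - 10)) := by rw [hns]
    _ ≤ max C 0 * (1 + s ^ (η - 10)) := mul_le_mul_of_nonneg_right hC hpos
    _ ≤ max C 0 * (s ^ (min η 10 - 10) + s ^ (min η 10 - 10)) := by gcongr
    _ = 2 * max C 0 * s ^ (min η 10 - 10) := by ring

/-- **Sufficiency for ONE datum `(G, r, sch, S₁)`** (the existence-leg form). If `S₁` carries the curvature package `W₁`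
of the crux (verbatim), is reflection positive in pull-back form for the four diagonal frames, and every continuous
kernel representing `S₁ 2` on `⁰𝒮` obeys the axial growth bound, then the conclusion of `CurvatureKernelBound` holds for
`S₁`. Reality of `S₁ 2` on real off-diagonal tensors is read off the lattice tie at `n = 2` (limits of real lattice
correlations). This is the pointwise content of `CurvatureKernelBoundReduction`; only these two properties OF THE
WITNESS are ever used by the route. [folklore] -/
theorem kernelConclusion_of_witness {G : Type} [Group G] [TopologicalSpace G] [IsTopologicalGroup G]
    [CompactSpace G] [MeasurableSpace G] [BorelSpace G] (r : LatticeRep G) (sch : SpeciesScheme (YMSpecies G))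
    (S₁ : SchwingerFamily (EuclideanSpace ℝ (Fin 4)))
    (hW₁ : (∀ (n : ℕ), n ≠ 0 → ∀ (f : Fin n → 𝓢((EuclideanSpace ℝ (Fin 4)), ℝ))
        (F : 𝓢((Fin n → EuclideanSpace ℝ (Fin 4)), ℂ)), IsTensorOf F (fun i => ofRealTest (f i)) →
        IsOffDiagonal F → Tendsto (fun k : ℕ => ((latticeSchwinger r.ρ sch (fun s => s.F) k n
          (fun _ => r.curvature) f : ℝ) : ℂ)) atTop (nhds (S₁ n F))) ∧
      (S₁.toLabelled.IsNormalized ∧ S₁.toLabelled.IsHermitian ∧ S₁.toLabelled.HasLinearGrowth ∧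
        S₁.toLabelled.IsReflectionPositive ∧ S₁.toLabelled.IsSymmetric ∧ S₁.toLabelled.HasClusterProperty) ∧
      (∀ (n : ℕ) (a : EuclideanSpace ℝ (Fin 4)) (F : 𝓢((Fin n → EuclideanSpace ℝ (Fin 4)), ℂ)),
        IsOffDiagonal F → S₁ n (translateMulti a F) = S₁ n F) ∧
      (∀ (R : EuclideanSpace ℝ (Fin 4) ≃ₗᵢ[ℝ] EuclideanSpace ℝ (Fin 4)),
        LinearMap.det (R.toLinearEquiv : EuclideanSpace ℝ (Fin 4) →ₗ[ℝ] EuclideanSpace ℝ (Fin 4)) = 1 →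
        (∀ i : Fin 4, ∃ j : Fin 4, R (EuclideanSpace.single i 1) = EuclideanSpace.single j 1 ∨
          R (EuclideanSpace.single i 1) = -EuclideanSpace.single j 1) →
        ∀ (n : ℕ) (F : 𝓢((Fin n → EuclideanSpace ℝ (Fin 4)), ℂ)), IsOffDiagonal F →
          S₁ n (linActMulti R F) = S₁ n F) ∧
      (∃ Δ : ℝ, 0 < Δ ∧ S₁.toLabelled.HasMassGap Δ ∧ HasLatticeMassGap r sch Δ))
    (hdiag : ∀ (R : EuclideanSpace ℝ (Fin 4) ≃ₗᵢ[ℝ] EuclideanSpace ℝ (Fin 4)) (a b : ℝ), a ^ 2 = 1 / 2 →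
      b ^ 2 = 1 / 2 → R (EuclideanSpace.single 0 1) = a • EuclideanSpace.single 0 1 + b • EuclideanSpace.single 1 1 →
      (SchwingerFamily.toLabelled (fun n => (S₁ n).comp (linActMulti R))).IsReflectionPositive)
    (hax : ∀ K : EuclideanSpace ℝ (Fin 4) → ℂ, ContinuousOn K {x : EuclideanSpace ℝ (Fin 4) | x ≠ 0} →
      (∀ F : 𝓢((Fin 2 → EuclideanSpace ℝ (Fin 4)), ℂ), IsOffDiagonal F →
        Integrable (fun x : Fin 2 → EuclideanSpace ℝ (Fin 4) => K (x 0 - x 1) * F x) ∧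
          S₁ 2 F = ∫ x : Fin 2 → EuclideanSpace ℝ (Fin 4), K (x 0 - x 1) * F x) →
      ∃ C η : ℝ, 0 < η ∧ ∀ s : ℝ, 0 < s → s ≤ 1 → ‖K (EuclideanSpace.single 0 s)‖ ≤ C * s ^ (η - 10)) :
    ∃ (K : EuclideanSpace ℝ (Fin 4) → ℝ) (C η : ℝ), 0 < η ∧ ContinuousOn K {x : EuclideanSpace ℝ (Fin 4) | x ≠ 0} ∧
      (∀ x : EuclideanSpace ℝ (Fin 4), x ≠ 0 → |K x| ≤ C * (1 + ‖x‖ ^ (η - 10))) ∧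
      ∀ F : 𝓢((Fin 2 → EuclideanSpace ℝ (Fin 4)), ℂ), IsOffDiagonal F →
        Integrable (fun x : Fin 2 → EuclideanSpace ℝ (Fin 4) => (K (x 0 - x 1) : ℂ) * F x) ∧
          S₁ 2 F = ∫ x : Fin 2 → EuclideanSpace ℝ (Fin 4), (K (x 0 - x 1) : ℂ) * F x := by
  obtain ⟨hconv, hpkg, htr, hhyp, -⟩ := hW₁
  -- reality of S₁ 2 on real off-diagonal tensors: a limit of real lattice correlations
  have hreal : ∀ (f : Fin 2 → 𝓢((EuclideanSpace ℝ (Fin 4)), ℝ)) (F : 𝓢((Fin 2 → EuclideanSpace ℝ (Fin 4)), ℂ)),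
      IsTensorOf F (fun i => ofRealTest (f i)) → IsOffDiagonal F → (S₁ 2 F).im = 0 := by
    intro f F hF hoff
    have ht := hconv 2 (by norm_num) f F hF hoff
    have hc := (Complex.continuous_im.tendsto _).comp ht
    have h0 : Tendsto (fun _ : ℕ => (0 : ℝ)) atTop (nhds (S₁ 2 F).im) := hc.congr (fun k => by simp)
    exact (tendsto_const_nhds_iff.mp h0).symm
  exact kernelConclusion_of_diagonalFrames_of_axialGrowth S₁ hpkg htr hhyp hdiag hreal hax

/-- **Registered sub-goal `KernelConclusionOfWitness`** (of stmt-QuantumFields-11687; let-free ∀-form of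
`kernelConclusion_of_witness`): for ONE datum `(G, r, sch, S₁)` carrying `W₁`, diagonal reflection positivity of `S₁`
and the axial growth bound for the continuous representing kernels of `S₁ 2` give the conclusion of
`CurvatureKernelBound` for `S₁`. [folklore] -/
theorem KernelConclusionOfWitness : open Literature.MathematicalPhysics.QuantumLattice Literature.MathematicalPhysics.AQFT Literature.MathematicalPhysics.QuantumFieldTheory in ∀ (G : Type) [Group G] [TopologicalSpace G] [IsTopologicalGroup G] [CompactSpace G] [MeasurableSpace G] [BorelSpace G] (r : LatticeRep G) (sch : SpeciesScheme (YMSpecies G)) (S₁ : SchwingerFamily (EuclideanSpace ℝ (Fin 4))), ((∀ (n : ℕ), n ≠ 0 → ∀ (f : Fin n → SchwartzMap (EuclideanSpace ℝ (Fin 4)) ℝ) (F : SchwartzMap (Fin n → (EuclideanSpace ℝ (Fin 4))) ℂ), IsTensorOf F (fun i => ofRealTest (f i)) → IsOffDiagonal F → Filter.Tendsto (fun k : ℕ => ((latticeSchwinger r.ρ sch (fun s => s.F) k n (fun _ => r.curvature) f : ℝ) : ℂ)) Filter.atTop (nhds (S₁ n F))) ∧ (S₁.toLabelled.IsNormalized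 ∧ S₁.toLabelled.IsHermitian ∧ S₁.toLabelled.HasLinearGrowth ∧ S₁.toLabelled.IsReflectionPositive ∧ S₁.toLabelled.IsSymmetric ∧ S₁.toLabelled.HasClusterProperty) ∧ (∀ (n : ℕ) (a : (EuclideanSpace ℝ (Fin 4))) (F : SchwartzMap (Fin n → (EuclideanSpace ℝ (Fin 4))) ℂ), IsOffDiagonal F → S₁ n (translateMulti a F) = S₁ n F) ∧ (∀ (R : (EuclideanSpace ℝ (Fin 4)) ≃ₗᵢ[ℝ] (EuclideanSpace ℝ (Fin 4))), LinearMap.det (R.toLinearEquiv : (EuclideanSpace ℝ (Fin 4)) →ₗ[ℝ] (EuclideanSpace ℝ (Fin 4))) = 1 → (∀ i : Fin 4, ∃ j : Fin 4, R (EuclideanSpace.single i 1) = EuclideanSpace.single j 1 ∨ R (EuclideanSpace.single i 1) = -EuclideanSpace.single j 1) → ∀ (n : ℕ) (F : SchwartzMap (Fin n → (EuclideanSpace ℝ (Fin 4))) ℂ), IsOffDiagonal F → S₁ n (linActMulti R F) = S₁ n F) ∧ (∃ Δ : ℝ, 0 < Δ ∧ S₁.toLabelled.HasMassGap Δ ∧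 HasLatticeMassGap r sch Δ)) → (∀ (R : (EuclideanSpace ℝ (Fin 4)) ≃ₗᵢ[ℝ] (EuclideanSpace ℝ (Fin 4))) (a b : ℝ), a ^ 2 = 1 / 2 → b ^ 2 = 1 / 2 → R (EuclideanSpace.single 0 1) = a • EuclideanSpace.single 0 1 + b • EuclideanSpace.single 1 1 → (SchwingerFamily.toLabelled (fun n => (S₁ n).comp (linActMulti R))).IsReflectionPositive) → (∀ (K : (EuclideanSpace ℝ (Fin 4)) → ℂ), ContinuousOn K {x : (EuclideanSpace ℝ (Fin 4)) | x ≠ 0} → (∀ F : SchwartzMap (Fin 2 → (EuclideanSpace ℝ (Fin 4))) ℂ, IsOffDiagonal F → MeasureTheory.Integrable (fun x : Fin 2 → (EuclideanSpace ℝ (Fin 4)) => K (x 0 - x 1) * F x) ∧ S₁ 2 F = ∫ x : Fin 2 → (EuclideanSpace ℝ (Fin 4)), K (x 0 - x 1) * F x) → ∃ C η : ℝ, 0 < η ∧ ∀ s : ℝ, 0 < s → s ≤ 1 → ‖K (EuclideanSpace.single 0 s)‖ ≤ C * s ^ (η - 10)) → ∃ (K : (EuclideanSpace ℝ (Fin 4))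 → ℝ) (C η : ℝ), 0 < η ∧ ContinuousOn K {x : (EuclideanSpace ℝ (Fin 4)) | x ≠ 0} ∧ (∀ x : (EuclideanSpace ℝ (Fin 4)), x ≠ 0 → |K x| ≤ C * (1 + ‖x‖ ^ (η - 10))) ∧ ∀ F : SchwartzMap (Fin 2 → (EuclideanSpace ℝ (Fin 4))) ℂ, IsOffDiagonal F → MeasureTheory.Integrable (fun x : Fin 2 → (EuclideanSpace ℝ (Fin 4)) => (K (x 0 - x 1) : ℂ) * F x) ∧ S₁ 2 F = ∫ x : Fin 2 → (EuclideanSpace ℝ (Fin 4)), (K (x 0 - x 1) : ℂ) * F x := by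
  intro G _ _ _ _ _ _ r sch S₁ hW₁ hdiag hax
  exact kernelConclusion_of_witness r sch S₁ hW₁ hdiag hax

end Summit.QuantumFields.YangMills.Theorems.CurvatureKernel

end
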